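import Summits.BirchSwinnertonDyer.BirchSwinnertonDyer.Theorems.KolyvaginRankRigidityAtTwoChebotarevTwoLevel
import HarnessLib

/-!
# Crux U1 `KolyvaginBoundedDefectAtTwo` (stmt-BirchSwinnertonDyer-28083), LINE 17 `regular_core_rigidity`,
# stub S1b `stub_nearCoreExistenceAtTwo` — THE WALK, part 1a: frame algebra

Width seat `bsd-line-krr2-p2` g15 (ONE READER on S1b); `--supports stmt-BirchSwinnertonDyer-28083` (helper).
THEOREMS ONLY; nothing here proves S1b, U1, a rung or BSD. BSD is NOT proved.

Generic bookkeeping for the frame-level walk (`…WalkStepGood`, `…WalkStepPure`): splitting coefficient vectors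
supported on `{i₁} ∪ A'` (`sum_single_add_indicator_smul`), the indicator kill-list (`sum_smul_indicator`), reading the
order `2^(k−j₁)` of a cut class off the independence exponent (`exists_addOrderOf_eq_two_pow`,
`two_pow_dvd_mul_of_zsmul_eq_zero`), `ℤ`-action helpers in the generic spelling (safe for `rw` on `H¹(K, E[2^k])`, whose
carrier has two syntactically different `ℤ`-module structures), and the additivity of the restriction
`x ↦ ([x, ρ])_{ρ ∈ Γ_{K(E[2^(k+1)])}}` on `H¹(K, E[2^k])` (`res_zsmul`, `res_sub`, `res_add`). [folklore]
[cite: GrossLMS1991, §9 (pairing after Prop. 9.1)]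
Design: no definitions; `K : Type`; axioms `propext`, `Classical.choice`, `Quot.sound`.
-/

set_option autoImplicit false
-- the Theorems namespace of this sub repeats the summit name by design (D-0017 nested layout)
set_option linter.dupNamespace false

noncomputable section

open scoped Classical
open Function NumberField WeierstrassCurve Field Finset
open Literature.NumberTheory.EllipticCurves Literature.NumberTheory.EllipticCurves.KolyvaginPairing
open Literature.NumberTheory.GaloisRepresentations
open Summit.BirchSwinnertonDyer.BirchSwinnertonDyer.Theorems.KolyvaginLowerBoundAtTwo (torsionFixing_le_of_dvd)

namespace Summit.BirchSwinnertonDyer.BirchSwinnertonDyer.Theorems.KolyvaginAtTwo.RegularWalk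

/-! ### §1 Algebra helpers -/

/-- Coefficient vectors supported on `{i₁} ∪ A'`: the sum splits. [folklore] -/
theorem sum_single_add_indicator_smul {ι G : Type*} [DecidableEq ι] [AddCommGroup G] (g : ι → G)
    {A A' : Finset ι} (hA' : A' ⊆ A) {i₁ : ι} (hi₁ : i₁ ∈ A) (a : ℤ) (b : ι → ℤ) :
    ∑ i ∈ A, ((if i = i₁ then a else 0) + (if i ∈ A' then b i else 0)) • g i = a • g i₁ + ∑ i ∈ A', b i • g i := by
  simp_rw [add_smul, Finset.sum_add_distrib, ite_smul, zero_smul]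
  rw [Finset.sum_ite_eq' A i₁, if_pos hi₁, Finset.sum_ite_mem, Finset.inter_eq_right.mpr hA']

/-- The indicator kill-list: `∑ᵢ bᵢ • (if i ∈ A' then gᵢ else 0) = ∑_{i ∈ A'} bᵢ • gᵢ`. [folklore] -/
theorem sum_smul_indicator {ι G : Type*} [Fintype ι] [DecidableEq ι] [AddCommGroup G] (g : ι → G)
    (A' : Finset ι) (b : ι → ℤ) :
    ∑ i, b i • (if i ∈ A' then g i else 0) = ∑ i ∈ A', b i • g i := by
  simp_rw [smul_ite, smul_zero]
  rw [Finset.sum_ite_mem, Finset.univ_inter]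

/-- Orders read off a cut: if `2^k • x = 0` and `a • x = 0 ⇒ 2^(k−d) ∣ a`, then `ord x = 2^(k−j₁)` with `j₁ ≤ d`,
`j₁ ≤ k`. [folklore] -/
theorem exists_addOrderOf_eq_two_pow {G : Type*} [AddCommGroup G] {x : G} {k d : ℕ} (hk : (2 ^ k) • x = 0)
    (hcut : ∀ a : ℤ, a • x = 0 → (2 : ℤ) ^ (k - d) ∣ a) :
    ∃ j₁ : ℕ, j₁ ≤ d ∧ j₁ ≤ k ∧ addOrderOf x = 2 ^ (k - j₁) := by
  have hdvd : addOrderOf x ∣ 2 ^ k := addOrderOf_dvd_of_nsmul_eq_zero hk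
  obtain ⟨N, hNk, hN⟩ := (Nat.dvd_prime_pow Nat.prime_two).mp hdvd
  have h0 : ((2 ^ N : ℕ) : ℤ) • x = 0 := by rw [natCast_zsmul, ← hN]; exact addOrderOf_nsmul_eq_zero x
  have h1 := hcut _ h0
  have h2 : 2 ^ (k - d) ∣ 2 ^ N := by
    have h1' : ((2 ^ (k - d) : ℕ) : ℤ) ∣ ((2 ^ N : ℕ) : ℤ) := by rwa [Nat.cast_pow, Nat.cast_ofNat]
    exact_mod_cast h1'
  have h3 : k - d ≤ N := (Nat.pow_dvd_pow_iff_le_right one_lt_two).mp h2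
  exact ⟨k - N, by omega, by omega, by rw [hN]; congr 1; omega⟩

/-- `ord x ∣` what kills `x`, in the form `2^(k − j₁) = ord x`, `a • x = 0 ⇒ 2^k ∣ 2^j₁ a`. [folklore] -/
theorem two_pow_dvd_mul_of_zsmul_eq_zero {G : Type*} [AddCommGroup G] {x : G} {k j₁ : ℕ} (hj₁ : j₁ ≤ k)
    (hord : addOrderOf x = 2 ^ (k - j₁)) {a : ℤ} (ha : a • x = 0) : (2 : ℤ) ^ k ∣ 2 ^ j₁ * a := by
  have h := (addOrderOf_dvd_iff_zsmul_eq_zero).mpr ha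
  rw [hord, Nat.cast_pow, Nat.cast_ofNat] at h
  have e : (2 : ℤ) ^ k = 2 ^ j₁ * 2 ^ (k - j₁) := by rw [← pow_add]; congr 1; omega
  rw [e]
  exact mul_dvd_mul_left _ h

/-- `n • ∑ = ∑ n •` for the `ℤ`-action of an abelian group (generic spelling, safe for `rw` on `H¹(K, E[n])`).
[folklore] -/
theorem zsmul_finset_sum {ι G : Type*} [AddCommGroup G] (n : ℤ) (s : Finset ι) (f : ι → G) :
    n • ∑ i ∈ s, f i = ∑ i ∈ s, n • f i :=
  Finset.smul_sum

/-- `a • b • x = (a * b) • x` for the `ℤ`-action of an abelian group (generic spelling). [folklore] -/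
theorem zsmul_zsmul_eq_mul_zsmul {G : Type*} [AddCommGroup G] (a b : ℤ) (x : G) : a • b • x = (a * b) • x :=
  smul_smul a b x

variable {K : Type} [Field K] [NumberField K] (W : WeierstrassCurve ℚ) [W.IsElliptic] [W.IsGloballyMinimal]

/-! ### §2 The restriction kernel is a subgroup (calculus of `res_{k+1}(·) = 0`) -/

omit [W.IsElliptic] [W.IsGloballyMinimal] in
/-- `res_{k+1}` is additive: scalar multiples. [folklore] -/
theorem res_zsmul (k : ℕ) (a : ℤ) (x : galH1Torsion (W.baseChange K) ((2 ^ k : ℕ) : ℤ))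
    {ρ : absoluteGaloisGroup K} (hρ : ρ ∈ torsionFixing (W.baseChange K) ((2 ^ (k + 1) : ℕ) : ℤ)) :
    h1Eval (W.baseChange K) ((2 ^ k : ℕ) : ℤ) (a • x) ρ = a • h1Eval (W.baseChange K) ((2 ^ k : ℕ) : ℤ) x ρ := by
  have hρ' : ρ ∈ torsionFixing (W.baseChange K) ((2 ^ k : ℕ) : ℤ) :=
    torsionFixing_le_of_dvd (W.baseChange K) (by exact_mod_cast Nat.pow_dvd_pow 2 (Nat.le_succ k)) hρ
  exact h1Eval_zsmul (W.baseChange K) ((2 ^ k : ℕ) : ℤ) a x hρ'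

omit [W.IsElliptic] [W.IsGloballyMinimal] in
/-- `res_{k+1}` is additive: differences. [folklore] -/
theorem res_sub (k : ℕ) (x y : galH1Torsion (W.baseChange K) ((2 ^ k : ℕ) : ℤ))
    {ρ : absoluteGaloisGroup K} (hρ : ρ ∈ torsionFixing (W.baseChange K) ((2 ^ (k + 1) : ℕ) : ℤ)) :
    h1Eval (W.baseChange K) ((2 ^ k : ℕ) : ℤ) (x - y) ρ =
      h1Eval (W.baseChange K) ((2 ^ k : ℕ) : ℤ) x ρ - h1Eval (W.baseChange K) ((2 ^ k : ℕ) : ℤ) y ρ := by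
  have hρ' : ρ ∈ torsionFixing (W.baseChange K) ((2 ^ k : ℕ) : ℤ) :=
    torsionFixing_le_of_dvd (W.baseChange K) (by exact_mod_cast Nat.pow_dvd_pow 2 (Nat.le_succ k)) hρ
  exact map_sub (h1EvalHom (W.baseChange K) ((2 ^ k : ℕ) : ℤ) hρ') x y

omit [W.IsElliptic] [W.IsGloballyMinimal] in
/-- `res_{k+1}` is additive: sums. [folklore] -/
theorem res_add (k : ℕ) (x y : galH1Torsion (W.baseChange K) ((2 ^ k : ℕ) : ℤ))
    {ρ : absoluteGaloisGroup K} (hρ : ρ ∈ torsionFixing (W.baseChange K) ((2 ^ (k + 1) : ℕ) : ℤ)) :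
    h1Eval (W.baseChange K) ((2 ^ k : ℕ) : ℤ) (x + y) ρ =
      h1Eval (W.baseChange K) ((2 ^ k : ℕ) : ℤ) x ρ + h1Eval (W.baseChange K) ((2 ^ k : ℕ) : ℤ) y ρ := by
  have hρ' : ρ ∈ torsionFixing (W.baseChange K) ((2 ^ k : ℕ) : ℤ) :=
    torsionFixing_le_of_dvd (W.baseChange K) (by exact_mod_cast Nat.pow_dvd_pow 2 (Nat.le_succ k)) hρ
  exact h1Eval_add (W.baseChange K) ((2 ^ k : ℕ) : ℤ) x y hρ'

end Summit.BirchSwinnertonDyer.BirchSwinnertonDyer.Theorems.KolyvaginAtTwo.RegularWalk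

end
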